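import Mathlib
import Summits.Ventures.PercRepro.TriangleCapThreeRowDiagonalLocus

/-!
# PercRepro — THE EQUALITY LOCUS ONE BELOW THE DIAGONAL AT SECOND ORDER, THE PIECES: on the cell `(k, a, 1)`
(`a ≥ 4`, `k ≥ 2a + 2`) at `Σ_v d(v)² + (k − 2) + 2 (k − 2a − 1)(a − 1) = m k`, the convexity is strict, a vertex of
degree `a − 1` is strictly below, the cross-row deletion is tight only on the boundary `k + 1 + d = 3a + 2` — where
`D − z = K_{a+1,k−a−2}` and the neighbours of `z` lie on its `(a + 1)`-side, except at `(11, 4, 1)`, `d = 2`, where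
they may sit on opposite sides of `K_{5,5}`: the hung `K_{5,5}` (p3, gen 44; part 197f)

`HungK55 D`: a vertex of degree `2` whose deletion is `K_{5,5}`, its neighbours on opposite sides — the `34,650 =
11 · 126 · 25` non-bipartite second-best graphs of `(11, 27)` (kit j314272); at most two vertices of degree `6`
(`hungK55_card_deg_six`). Axioms: standard.
-/

namespace PercRepro

namespace TriangleCap

namespace C047

open Finset

variable {V : Type*} [Fintype V] [DecidableEq V]

/-- **`K_{5,5}` WITH A VERTEX HUNG ON AN EDGE:** a vertex `z` of degree `2` whose deletion is a spanning subgraph of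
`K(A, Aᶜ)` with `|A| = 5` and `25` edges, the two neighbours of `z` on opposite sides. -/
def HungK55 (D : SimpleGraph V) [DecidableRel D.Adj] : Prop :=
  ∃ (z : V) (A : Finset {v : V // v ≠ z}), deg D z = 2 ∧ A.card = 5 ∧ BipSub (del D z) A ∧
    (del D z).edgeFinset.card = 25 ∧ ∃ x y : {v : V // v ≠ z}, x ∈ A ∧ y ∉ A ∧ D.Adj x.1 z ∧ D.Adj y.1 z

/-- In the hung `K_{5,5}` at most two vertices have degree `6`. -/
theorem hungK55_card_deg_six (D : SimpleGraph V) [DecidableRel D.Adj] (hk : Fintype.card V = 11)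
    (hH : HungK55 D) (S : Finset V) (hS : ∀ w ∈ S, deg D w = 6) : S.card ≤ 2 := by
  obtain ⟨z, A, hz2, hA5, hB, -, -⟩ := hH
  have hcard' := card_del z
  have hsub : S ⊆ univ.filter (fun w => D.Adj z w) := by
    intro w hw
    have hw6 := hS w hw
    rw [mem_filter]
    refine ⟨mem_univ _, ?_⟩
    have hwz : w ≠ z := fun h => by rw [h] at hw6; omega
    have hd := deg_del D z ⟨w, hwz⟩
    have hle : deg (del D z) ⟨w, hwz⟩ ≤ 5 := by
      by_cases hwA : (⟨w, hwz⟩ : {v : V // v ≠ z}) ∈ A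
      · have := deg_le_of_bipSub_mem (del D z) A hB _ hwA
        rw [hA5] at this
        omega
      · have := deg_le_card_of_bipSub (del D z) A hB _ hwA
        rw [hA5] at this
        exact this
    simp only at hd
    by_contra hadj
    rw [if_neg (fun h => hadj (D.adj_symm h))] at hd
    omega
  have := card_le_card hsub
  unfold deg at hz2
  omega

omit [DecidableEq V] in
/-- **THE CONVEXITY IS STRICT ONE BELOW THE DIAGONAL:** every degree in `[a + 1, k − a − 1]`, `2a + 2 ≤ k`, `a ≥ 2` ⇒
`Σ_v d(v)² + (k − 2) + 2 (k − 2a − 1)(a − 1) < m k`. -/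
theorem one_convex_strict (D : SimpleGraph V) [DecidableRel D.Adj] (a : ℕ) (ha : 2 ≤ a)
    (hk : 2 * a + 2 ≤ Fintype.card V) (hm : D.edgeFinset.card + 1 = a * (Fintype.card V - a))
    (hcap : ∀ v, deg D v + a + 1 ≤ Fintype.card V) (hdeg : ∀ v, a + 1 ≤ deg D v) :
    ∑ v, deg D v * deg D v + (Fintype.card V - 2) + 2 * (Fintype.card V - 2 * a - 1) * (a - 1) <
      D.edgeFinset.card * Fintype.card V := by
  have h := below_convex_gen D a 1 (by omega) (by omega) hm hcap hdeg
  have e : Fintype.card V - 1 - 1 = Fintype.card V - 2 := by omega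
  rw [e, one_mul] at h
  have h2 : 2 * (Fintype.card V - 2 * a - 1) * (a - 1) < Fintype.card V * (Fintype.card V - 2 * a - 1) := by
    rw [mul_right_comm]
    exact Nat.mul_lt_mul_of_pos_right (by omega) (by omega)
  omega

/-- The envelope regime one below is strict: with `e ≥ 1` the slack `e (e + c + 2d)` is positive
(`a = c + 1 + d + e`, `k = 2a + 2 + c`). -/
theorem one_cross_env_strict (d c e m' S' T : ℕ) (he : 1 ≤ e)
    (hm' : m' + d + 1 = (c + 1 + d + e) * (c + 1 + d + e + 2 + c))
    (hS' : S' ≤ m' * (2 * (c + 1 + d + e) + 1 + c))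
    (hT : T ≤ d * (c + 1 + d + e + c)) :
    S' + 2 * T + d + d * d + (2 * (c + 1 + d + e) + c) + 2 * (c + 1) * (c + d + e) <
      (m' + d) * (2 * (c + 1 + d + e) + 2 + c) := by
  nlinarith [hS', hT, Nat.mul_le_mul he (Nat.le_add_left 1 (c + 2 * d + e - 1)), Nat.zero_le ((2 * d + c + e) * e)]

/-- The closed-form regime one below is strict off the boundary: with `t ≥ 1` the slack `2t (b + 2)` is positive
(`a = d + 2 + b`, `k = 2d + 3b + 7 + t`). -/
theorem one_cross_cell_strict (d b t m' S' T : ℕ) (ht : 1 ≤ t)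
    (hm' : m' + d + 1 = (d + 2 + b) * (d + 2 * b + 5 + t))
    (hS' : S' + t * (2 * d + 3 * b + 5) ≤ m' * (2 * d + 3 * b + 6 + t))
    (hT : T ≤ d * (d + 2 * b + 3 + t)) :
    S' + 2 * T + d + d * d + (2 * d + 3 * b + 5 + t) + 2 * (b + 2 + t) * (d + 1 + b) <
      (m' + d) * (2 * d + 3 * b + 7 + t) := by
  nlinarith [hS', hT, Nat.mul_le_mul ht (le_refl (b + 2))]

/-- On the boundary (`t = 0`) equality forces the two bounds to be tight. -/
theorem one_cross_cell_eq (d b m' S' T : ℕ)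
    (hm' : m' + d + 1 = (d + 2 + b) * (d + 2 * b + 5))
    (hS' : S' ≤ m' * (2 * d + 3 * b + 6)) (hT : T ≤ d * (d + 2 * b + 3))
    (heq : S' + 2 * T + d + d * d + (2 * d + 3 * b + 5) + 2 * (b + 2) * (d + 1 + b) = (m' + d) * (2 * d + 3 * b + 7)) :
    S' = m' * (2 * d + 3 * b + 6) ∧ T = d * (d + 2 * b + 3) := by
  have h : S' + 2 * T = m' * (2 * d + 3 * b + 6) + 2 * (d * (d + 2 * b + 3)) := by nlinarith [heq, hm']
  omega

/-- **THE BOUNDARY OF THE CROSS-ROW CASE ONE BELOW THE DIAGONAL:** with the envelope of `D − z` below the boundary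
`k + 1 + d = 3a + 2` and the closed form on the cell `(k − 1, a + 1, k + 1 + d − 3a − 2)` beyond, equality forces
the boundary, `D − z` at the envelope and the neighbours of `z` at `k − a − 2`. -/
theorem one_cross_boundary (a d k m' S' T : ℕ) (hk : 2 * a + 2 ≤ k) (hz : d + 2 ≤ a)
    (hmd : m' + d + 1 = a * (k - a)) (hT : T ≤ d * (k - a - 2))
    (henv : k + 1 + d < 3 * a + 2 → S' ≤ m' * (k - 1))
    (hcell : 3 * a + 2 ≤ k + 1 + d →
      S' + (k + 1 + d - (3 * a + 2)) * (k - 1 - 1 - (k + 1 + d - (3 * a + 2))) ≤ m' * (k - 1))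
    (heq : S' + 2 * T + d + d * d + (k - 1 - 1) + 2 * (k - 2 * a - 1) * (a - 1) = (m' + d) * k) :
    k + 1 + d = 3 * a + 2 ∧ S' = m' * (k - 1) ∧ T = d * (k - a - 2) := by
  rcases Nat.lt_or_ge (k + 1 + d) (3 * a + 2) with hsmall | hlarge
  · exfalso
    have henv' := henv hsmall
    obtain ⟨c, hc⟩ : ∃ c, k = 2 * a + 2 + c := ⟨k - (2 * a + 2), by omega⟩
    obtain ⟨e, he⟩ : ∃ e, k + 1 + d + e = 3 * a + 2 := ⟨3 * a + 2 - (k + 1 + d), by omega⟩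
    have he1 : 1 ≤ e := by omega
    obtain rfl : a = c + 1 + d + e := by omega
    subst hc
    have e1 : 2 * (c + 1 + d + e) + 2 + c - 1 = 2 * (c + 1 + d + e) + 1 + c := by omega
    have e2 : 2 * (c + 1 + d + e) + 2 + c - (c + 1 + d + e) - 2 = c + 1 + d + e + c := by omega
    have e3 : 2 * (c + 1 + d + e) + 2 + c - 2 * (c + 1 + d + e) - 1 = c + 1 := by omega
    have e4 : 2 * (c + 1 + d + e) + 2 + c - (c + 1 + d + e) = c + 1 + d + e + 2 + c := by omega
    have e5 : 2 * (c + 1 + d + e) + 2 + c - 1 - 1 = 2 * (c + 1 + d + e) + c := by omega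
    have e6 : c + 1 + d + e - 1 = c + d + e := by omega
    rw [e1] at henv'
    rw [e2] at hT
    rw [e4] at hmd
    rw [e3, e5, e6] at heq
    have := one_cross_env_strict d c e m' S' T he1 hmd henv' hT
    omega
  · have hcell' := hcell hlarge
    obtain ⟨t, ht⟩ : ∃ t, k + 1 + d = 3 * a + 2 + t := ⟨k + 1 + d - (3 * a + 2), by omega⟩
    obtain ⟨b, hb⟩ : ∃ b, a = d + 2 + b := ⟨a - (d + 2), by omega⟩
    subst hb
    obtain rfl : k = 2 * d + 3 * b + 7 + t := by omega
    have e0 : 2 * d + 3 * b + 7 + t - (d + 2 + b) = d + 2 * b + 5 + t := by omega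
    have e1 : 2 * d + 3 * b + 7 + t + 1 + d - (3 * (d + 2 + b) + 2) = t := by omega
    have e2 : 2 * d + 3 * b + 7 + t - 1 - 1 - t = 2 * d + 3 * b + 5 := by omega
    have e3 : 2 * d + 3 * b + 7 + t - 1 = 2 * d + 3 * b + 6 + t := by omega
    have e4 : 2 * d + 3 * b + 7 + t - (d + 2 + b) - 2 = d + 2 * b + 3 + t := by omega
    have e5 : 2 * d + 3 * b + 7 + t - 2 * (d + 2 + b) - 1 = b + 2 + t := by omega
    have e6 : 2 * d + 3 * b + 7 + t - 1 - 1 = 2 * d + 3 * b + 5 + t := by omega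
    have e7 : d + 2 + b - 1 = d + 1 + b := by omega
    rw [e0] at hmd
    rw [e1, e2, e3] at hcell'
    rw [e4] at hT
    rw [e5, e6, e7] at heq
    rcases Nat.eq_zero_or_pos t with ht0 | ht1
    · subst ht0
      simp only [zero_mul, add_zero] at hcell' hT heq
      obtain ⟨h1, h2⟩ := one_cross_cell_eq d b m' S' T hmd hcell' hT heq
      refine ⟨by omega, ?_, ?_⟩
      · rw [e3]; exact h1
      · rw [e4]; exact h2
    · exfalso
      have := one_cross_cell_strict d b t m' S' T ht1 hmd hcell' hT
      omega

/-- On the boundary `k + 1 + d = 3a + 2` the edge count of `D − z` is that of `K_{a+1,k−a−2}`. -/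
theorem one_cross_eq_edges (a d k m' : ℕ) (hkd : k + 1 + d = 3 * a + 2) (hz : d + 2 ≤ a)
    (hmd : m' + d + 1 = a * (k - a)) :
    m' + (a + 1) * (a + 1) + 0 = (a + 1) * (k - 1) ∧ m' + 0 = (a + 1) * (k - 1 - (a + 1)) := by
  obtain ⟨b, hb⟩ : ∃ b, a = d + 2 + b := ⟨a - (d + 2), by omega⟩
  subst hb
  obtain rfl : k = 2 * d + 3 * b + 7 := by omega
  have e0 : 2 * d + 3 * b + 7 - (d + 2 + b) = d + 2 * b + 5 := by omega
  have e1 : 2 * d + 3 * b + 7 - 1 = 2 * d + 3 * b + 6 := by omega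
  have e2 : 2 * d + 3 * b + 6 - (d + 2 + b + 1) = d + 2 * b + 3 := by omega
  rw [e0] at hmd
  rw [e1, e2]
  constructor <;> nlinarith [hmd]

/-- **THE CROSS-ROW CASE AT EQUALITY ONE BELOW, THE STRUCTURE:** on the boundary, `D − z = K_{a+1,k−a−2}` and the
neighbours of `z` at `k − a − 2` ⇒ `D` is `(a + 1)`-bipartite — or `a = 4`, `k = 11`, `d = 2` and `D` is the hung
`K_{5,5}`. -/
theorem one_cross_structure (D : SimpleGraph V) [DecidableRel D.Adj] (hK : K4mFree D) (a : ℕ) (ha : 4 ≤ a)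
    (z : V) (hkd : Fintype.card V + 1 + deg D z = 3 * a + 2) (hz : deg D z + 2 ≤ a)
    (hmd : (del D z).edgeFinset.card + deg D z + 1 = a * (Fintype.card V - a))
    (hS'eq : ∑ w : {v : V // v ≠ z}, deg (del D z) w * deg (del D z) w =
      (del D z).edgeFinset.card * Fintype.card {v : V // v ≠ z})
    (hdeg : ∀ w : {v : V // v ≠ z}, D.Adj w.1 z → deg (del D z) w = Fintype.card V - a - 2) :
    (∃ A : Finset V, A.card = a + 1 ∧ BipSub D A) ∨ (a = 4 ∧ Fintype.card V = 11 ∧ HungK55 D) := by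
  have hK' := k4mFree_del D hK z
  have hcard' := card_del z
  obtain ⟨k, hk'⟩ : ∃ k, Fintype.card V = k := ⟨_, rfl⟩
  have hk'' : Fintype.card {v : V // v ≠ z} = k - 1 := by omega
  obtain ⟨d, hd⟩ : ∃ d, deg D z = d := ⟨_, rfl⟩
  obtain ⟨m', hm'def⟩ : ∃ m', (del D z).edgeFinset.card = m' := ⟨_, rfl⟩
  rw [hk'] at hkd hmd hdeg ⊢
  rw [hd] at hkd hz hmd
  rw [hm'def] at hmd
  obtain ⟨he1, he2⟩ := one_cross_eq_edges a d k m' hkd hz hmd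
  obtain ⟨A', -, hA'card, hA', -⟩ := (closed_form_eq_iff (del D z) hK' (a + 1) 0 (by omega)
    (by rw [hk'']; omega) (by rw [hk'']; omega) (by rw [hm'def, hk'']; exact he1)).mp (by
      rw [hS'eq]
      simp only [zero_mul, add_zero])
  rcases Nat.lt_or_ge (2 * a + 3) k with hk4 | hk3
  · -- `k ≥ 2a + 4`: a vertex off `A'` has degree `≤ a + 1 < k − a − 2`
    left
    have hin : ∀ w : {v : V // v ≠ z}, D.Adj w.1 z → w ∈ A' := by
      intro w hw
      by_contra hwA
      have h1 := deg_le_card_of_bipSub (del D z) A' hA' w hwA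
      have h2 := hdeg w hw
      omega
    obtain ⟨B, hBcard, hB⟩ := bipSub_lift D z A' hA' hin
    exact ⟨B, by rw [hBcard, hA'card], hB⟩
  · -- `k = 2a + 3`, `d = a − 2`
    have hk23 : k = 2 * a + 3 := by omega
    have hm'0 : (del D z).edgeFinset.card + 0 = (a + 1) * (Fintype.card {v : V // v ≠ z} - (a + 1)) := by
      rw [hm'def, hk'']; exact he2
    rcases Nat.lt_or_ge 4 a with ha5 | ha4'
    · -- `a ≥ 5`, `d = a − 2 ≥ 3`: the neighbours of `z` lie on one side, both of size `a + 1`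
      left
      rcases nbhd_one_side_of_bipSub D hK z A' (a + 1) 0 hA'card hA' hm'0 (by omega) with hin | hoff
      · obtain ⟨B, hBcard, hB⟩ := bipSub_lift D z A' hA' hin
        exact ⟨B, by rw [hBcard, hA'card], hB⟩
      · have hA'c : BipSub (del D z) A'ᶜ := bipSub_compl (del D z) A' hA'
        obtain ⟨B, hBcard, hB⟩ := bipSub_lift D z A'ᶜ hA'c (fun w hw => mem_compl.mpr (hoff w hw))
        refine ⟨B, ?_, hB⟩
        rw [hBcard, card_compl, hA'card, hk'', hk23]
        omega
    · -- `a = 4`, `k = 11`, `d = 2`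
      have ha4'' : a = 4 := by omega
      subst ha4''
      by_cases hin : ∀ w : {v : V // v ≠ z}, D.Adj w.1 z → w ∈ A'
      · left
        obtain ⟨B, hBcard, hB⟩ := bipSub_lift D z A' hA' hin
        exact ⟨B, by rw [hBcard, hA'card], hB⟩
      by_cases hoff : ∀ w : {v : V // v ≠ z}, D.Adj w.1 z → w ∉ A'
      · left
        have hA'c : BipSub (del D z) A'ᶜ := bipSub_compl (del D z) A' hA'
        obtain ⟨B, hBcard, hB⟩ := bipSub_lift D z A'ᶜ hA'c (fun w hw => mem_compl.mpr (hoff w hw))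
        refine ⟨B, ?_, hB⟩
        rw [hBcard, card_compl, hA'card, hk'', hk23]
      · right
        push Not at hin hoff
        obtain ⟨y, hyz, hyA⟩ := hin
        obtain ⟨x, hxz, hxA⟩ := hoff
        refine ⟨rfl, hk23, z, A', by omega, hA'card, hA', ?_, x, y, hxA, hyA, hxz, hyz⟩
        rw [hm'def]
        omega

/-- **THE CROSS-ROW CASE AT EQUALITY ONE BELOW THE DIAGONAL:** `m + 1 = a (k − a)`, `4 ≤ a`, `2a + 2 ≤ k`, every degree
`≤ k − a − 1`, a vertex `z` of degree `≤ a − 2`, `Σ_v d(v)² + (k − 2) + 2 (k − 2a − 1)(a − 1) = m k` ⇒ `D` is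
`(a + 1)`-bipartite, or `(a, k) = (4, 11)` and `D` is the hung `K_{5,5}`. -/
theorem one_cross_eq (D : SimpleGraph V) [DecidableRel D.Adj] (hK : K4mFree D) (a : ℕ) (ha : 4 ≤ a)
    (hk : 2 * a + 2 ≤ Fintype.card V) (hm : D.edgeFinset.card + 1 = a * (Fintype.card V - a))
    (hcap : ∀ v, deg D v + a + 1 ≤ Fintype.card V) (z : V) (hz : deg D z + 2 ≤ a)
    (heq : ∑ v, deg D v * deg D v + (Fintype.card V - 2) + 2 * (Fintype.card V - 2 * a - 1) * (a - 1) =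
      D.edgeFinset.card * Fintype.card V) :
    (∃ A : Finset V, A.card = a + 1 ∧ BipSub D A) ∨ (a = 4 ∧ Fintype.card V = 11 ∧ HungK55 D) := by
  have hK' := k4mFree_del D hK z
  have hcard' := card_del z
  have hedges' := card_edges_del D z
  have hsq := sum_deg_sq_del D z
  have hT := sum_del_nbhd_le D z (Fintype.card V - a - 2) (fun v => by have := hcap v; omega)
  have hmd : (del D z).edgeFinset.card + deg D z + 1 = a * (Fintype.card V - a) := by rw [hedges']; exact hm
  obtain ⟨T, hTdef⟩ : ∃ T, ∑ w : {v : V // v ≠ z}, (if D.Adj w.1 z then deg (del D z) w else 0) = T := ⟨_, rfl⟩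
  obtain ⟨S', hS'def⟩ : ∃ S', ∑ w : {v : V // v ≠ z}, deg (del D z) w * deg (del D z) w = S' := ⟨_, rfl⟩
  obtain ⟨m', hm'def⟩ : ∃ m', (del D z).edgeFinset.card = m' := ⟨_, rfl⟩
  obtain ⟨d, hd⟩ : ∃ d, deg D z = d := ⟨_, rfl⟩
  obtain ⟨k, hk'⟩ : ∃ k, Fintype.card V = k := ⟨_, rfl⟩
  have hk'' : Fintype.card {v : V // v ≠ z} = k - 1 := by omega
  have henv : k + 1 + d < 3 * a + 2 → S' ≤ m' * (k - 1) := fun _ => by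
    have h := sum_deg_sq_le_of_k4mFree (del D z) hK' (by omega)
    rw [hS'def, hm'def, hk''] at h
    exact h
  have hcell : 3 * a + 2 ≤ k + 1 + d →
      S' + (k + 1 + d - (3 * a + 2)) * (k - 1 - 1 - (k + 1 + d - (3 * a + 2))) ≤ m' * (k - 1) := fun hl => by
    obtain ⟨hc2, hc3⟩ := below_cross_cell_side a 1 d k m' (by omega) (by omega)
      (by rw [← hm'def, ← hd, ← hk']; exact hmd)
    rw [← hk''] at hc2 hc3
    rw [← hm'def] at hc3
    have h := closed_form_stability (del D z) hK' (a + 1) (k + 1 + d - (3 * a + 2)) (by omega) hc2 hc3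
    rw [hS'def, hm'def, hk''] at h
    exact h
  rw [hd] at hz hedges' hsq hT hmd
  rw [hTdef] at hsq hT
  rw [hS'def] at hsq
  rw [hm'def] at hedges' hmd
  rw [hk'] at hk hm hT heq hmd
  rw [hsq, ← hedges'] at heq
  have heq' : S' + 2 * T + d + d * d + (k - 1 - 1) + 2 * (k - 2 * a - 1) * (a - 1) = (m' + d) * k := by
    have e : k - 1 - 1 = k - 2 := by omega
    rw [e]; exact heq
  obtain ⟨hkd, hS'eq, hTeq'⟩ := one_cross_boundary a d k m' S' T hk hz hmd hT henv hcell heq'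
  have hTeq := deg_del_eq_of_sum_eq D z (Fintype.card V - a - 2) (fun v => by have := hcap v; omega)
    (by rw [hTdef, hd, hk', hTeq'])
  apply one_cross_structure D hK a ha z (by omega) (by omega) (by rw [← hm'def, ← hd] at hmd; rw [hk']; exact hmd)
  · rw [hS'def, hm'def, hk'']; exact hS'eq
  · intro w hw; exact hTeq w hw

/-- The within-row deletion of a vertex of degree `a − 1` is strictly below for `k ≥ 2a + 3` (the slack
`2 (k − 2a − 2)`) and, at `k = 2a + 2`, tight only with `D − z` at the envelope. -/
theorem one_within_minus (a c m' S' T : ℕ) (ha : 1 ≤ a)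
    (hm' : m' + (a - 1) + 1 = a * (a + 2 + c))
    (hgap : S' + 2 * a * c ≤ m' * (2 * a + 1 + c)) (hT : T ≤ (a - 1) * (a + c))
    (heq : S' + 2 * T + (a - 1) + (a - 1) * (a - 1) + (2 * a + c) + 2 * (c + 1) * (a - 1) =
      (m' + (a - 1)) * (2 * a + 2 + c)) :
    c = 0 ∧ S' = m' * (2 * a + 1 + c) := by
  obtain ⟨a', rfl⟩ : ∃ a', a = a' + 1 := ⟨a - 1, by omega⟩
  have e : a' + 1 - 1 = a' := by omega
  rw [e] at hm' hT heq
  have h : c = 0 := by nlinarith [hgap, hT, hm', heq]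
  refine ⟨h, ?_⟩
  subst h
  nlinarith [hgap, hT, hm', heq]

/-- The within-row deletion of a vertex of degree `a` at equality forces `D − z` at the second-best value of
`(k − 1, a, 1)` and the neighbours of `z` at `k − a − 2`. -/
theorem one_within_eq_gap (a c m' S' T : ℕ) (ha : 1 ≤ a) (hm' : m' + a + 1 = a * (a + 2 + c))
    (hgap : S' + (2 * a + c - 1) + 2 * c * (a - 1) ≤ m' * (2 * a + 1 + c)) (hT : T ≤ a * (a + c))
    (heq : S' + 2 * T + a + a * a + (2 * a + c) + 2 * (c + 1) * (a - 1) = (m' + a) * (2 * a + 2 + c)) :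
    S' + (2 * a + c - 1) + 2 * c * (a - 1) = m' * (2 * a + 1 + c) ∧ T = a * (a + c) := by
  obtain ⟨a', rfl⟩ : ∃ a', a = a' + 1 := ⟨a - 1, by omega⟩
  have e : a' + 1 - 1 = a' := by omega
  have e2 : 2 * (a' + 1) + c - 1 = 2 * a' + 1 + c := by omega
  rw [e, e2] at hgap
  rw [e] at heq
  rw [e2, e]
  have h : S' + 2 * T + (2 * a' + 1 + c) + 2 * c * a' =
      m' * (2 * (a' + 1) + 1 + c) + 2 * ((a' + 1) * (a' + 1 + c)) := by nlinarith [heq, hm']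
  omega

end C047

end TriangleCap

end PercRepro
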